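import Summits.AtomisticToContinuum.Crystallization.Theorems.SquareWellLayerCakeStackingFaultSparsityLocalFramesFinal
import Summits.AtomisticToContinuum.Crystallization.Theorems.SquareWellLayerCakeStackingFaultSparsityLocalFramesLimit
import Summits.AtomisticToContinuum.Crystallization.Theorems.SquareWellLayerCakeStackingFaultSparsityLocalFramesDichotomy
import Summits.AtomisticToContinuum.Crystallization.Theorems.SquareWellLayerCakeStackingFaultSparsityLocalFramesCommonNormal
import Summits.AtomisticToContinuum.Crystallization.Theorems.SquareWellLayerCakeStackingFaultSparsityLocalFramesOneLength

/-!
# Radius bootstrap of crux 14294, stub W3: strengthened local rigidity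

Crux `StackingFaultSparsity` (stmt-AtomisticToContinuum-14296), line `Sketch`, reshape 14 (lead c8): registered stub
`stub_strongRigidity`.  Given W2's statement (level gap `≥ 19/25` in the common-normal case): for every `R` and `ε > 0`
there is `m` such that an all-GOOD`(2, 1, 1/(m+1))` `m`-ball around `y i` forces a two-way `ε`-matched window of
radius `R` onto `barlowStacking a h s` with `19/20 ≤ a ≤ 1`, `19/25 ≤ h`, `(19/20)² ≤ a²/3 + h² ≤ 1`.
Proof: `localRigidity_of_stubs` (compactness + contradiction; S0 `stub_localFrameLimit` landed) run with a
strengthened `barlow_of_localFrames` keeping the bounds the landed S12 / S3 already carry (`X = g '' barlowStacking a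
√(b² − a²/3) s` with the frames' `a, b ∈ [19/20, 1]`; gap `≥ 19/25` by W2 in the two-length case, `= a√(2/3)` in the
one-length case).  All `[folklore]`.
-/

noncomputable section

namespace Summit.AtomisticToContinuum.Crystallization.Theorems.SquareWellLayerCake.StackingFaultSparsity.Bootstrap.StrongRigidity

open Literature.MathematicalPhysics.StatisticalMechanics
open Summit.AtomisticToContinuum.Crystallization.Theorems.PeriodicWindowsSketch (sqrt_gap_bounds)
open Summit.AtomisticToContinuum.Crystallization.Theorems.SquareWellLayerCake.StackingFaultSparsity.LocalFrames.Structure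
open Summit.AtomisticToContinuum.Crystallization.Theorems.SquareWellLayerCake.StackingFaultSparsity.LocalFrames.Final
  (isometryEquiv_apply_eq)
open Summit.AtomisticToContinuum.Crystallization.Theorems.SquareWellLayerCake.StackingFaultSparsity.LocalFrames.Limit
  (stub_localFrameLimit)
open Summit.AtomisticToContinuum.Crystallization.Theorems.SquareWellLayerCake.StackingFaultSparsity.LocalFrames.OneLength
  (stub_barlowOfOneLength)
open Summit.AtomisticToContinuum.Crystallization.Theorems.SquareWellLayerCake.StackingFaultSparsity.LocalFrames.CommonNormal
  (stub_barlowOfCommonNormal)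
open Summit.AtomisticToContinuum.Crystallization.Theorems.SquareWellLayerCake.StackingFaultSparsity.LocalFrames.Dichotomy
  (stub_frameDichotomy)

/-- **Strengthened exact local-to-global structure theorem.**  Copy of
`LocalFrames.Structure.barlow_of_localFrames` with the landed S12 / S3 / S4 used by name and the parameter window
kept: `19/20 ≤ a ≤ 1`, `19/25 ≤ h`, `(19/20)² ≤ a²/3 + h² ≤ 1` (gap `≥ 19/25` from the hypothesis `hGap` in the
two-length case, `h² = 2a²/3` in the one-length case). [folklore] -/
theorem barlow_of_localFrames' :
    (∀ (X : Set (EuclideanSpace ℝ (Fin 3))) (a b : ℝ) (n : EuclideanSpace ℝ (Fin 3)), X.Nonempty → (∀ p ∈ X, (∃ c : ℤ → ℝ, (19 / 20 ≤ a ∧ a ≤ 1 ∧ 19 / 20 ≤ b ∧ b ≤ 1 ∧ ‖n‖ = 1 ∧ c 0 = 0 ∧ (∀ k : ℤ, c k + 19 / 25 ≤ c (k + 1)) ∧ (∀ q ∈ X, ∀ r ∈ X, q ≠ r → 19 / 20 ≤ dist q r) ∧ (∀ q ∈ X, dist q p < 2 → ∃ k : ℤ, inner ℝ (q - p) n = c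 k) ∧ (∃ H U D : Finset (EuclideanSpace ℝ (Fin 3)), H.card = 6 ∧ U.card = 3 ∧ D.card = 3 ∧ (∀ q ∈ H, q ∈ X ∧ inner ℝ (q - p) n = 0 ∧ dist p q = a) ∧ (∀ q ∈ U, q ∈ X ∧ inner ℝ (q - p) n = c 1 ∧ dist p q = b) ∧ (∀ q ∈ D, q ∈ X ∧ inner ℝ (q - p) n = c (-1) ∧ dist p q = b) ∧ (∀ q ∈ X, q ≠ p → dist q p ≤ 1 → q ∈ H ∨ q ∈ U ∨ q ∈ D)) ∧ (∀ q ∈ X, q ≠ p → dist q p ≤ 1 → (∃ H' : Finset (EuclideanSpace ℝ (Fin 3)), H'.card = 6 ∧ ∀ r ∈ H', r ∈ X ∧ r ≠ q ∧ inner ℝ (r - p) n = inner ℝ (q - p) n ∧ dist q r = a) ∧ (∃ U' : Finset (EuclideanSpace ℝ (Fin 3)), U'.card = 3 ∧ ∀ r ∈ U', r ∈ X ∧ (∃ k : ℤ, inner ℝ (q - p) n = c k ∧ inner ℝ (r - p) n = c (k + 1)) ∧ dist q r = b) ∧ (∃ D' : Finset (EuclideanSpace ℝ (Fin 3)), D'.card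 = 3 ∧ ∀ r ∈ D', r ∈ X ∧ (∃ k : ℤ, inner ℝ (q - p) n = c k ∧ inner ℝ (r - p) n = c (k - 1)) ∧ dist q r = b) ∧ (∀ r ∈ X, r ≠ q → dist q r < 1 → (inner ℝ (r - p) n = inner ℝ (q - p) n → dist q r = a) ∧ (inner ℝ (r - p) n ≠ inner ℝ (q - p) n → dist q r = b))))) ∨ (∃ c : ℤ → ℝ, (19 / 20 ≤ a ∧ a ≤ 1 ∧ 19 / 20 ≤ b ∧ b ≤ 1 ∧ ‖(-n)‖ = 1 ∧ c 0 = 0 ∧ (∀ k : ℤ, c k + 19 / 25 ≤ c (k + 1)) ∧ (∀ q ∈ X, ∀ r ∈ X, q ≠ r → 19 / 20 ≤ dist q r) ∧ (∀ q ∈ X, dist q p < 2 → ∃ k : ℤ, inner ℝ (q - p) (-n) = c k) ∧ (∃ H U D : Finset (EuclideanSpace ℝ (Fin 3)), H.card = 6 ∧ U.card = 3 ∧ D.card = 3 ∧ (∀ q ∈ H, q ∈ X ∧ inner ℝ (q - p) (-n) = 0 ∧ dist p q = a) ∧ (∀ q ∈ U, q ∈ X ∧ inner ℝ (q - p) (-n)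 = c 1 ∧ dist p q = b) ∧ (∀ q ∈ D, q ∈ X ∧ inner ℝ (q - p) (-n) = c (-1) ∧ dist p q = b) ∧ (∀ q ∈ X, q ≠ p → dist q p ≤ 1 → q ∈ H ∨ q ∈ U ∨ q ∈ D)) ∧ (∀ q ∈ X, q ≠ p → dist q p ≤ 1 → (∃ H' : Finset (EuclideanSpace ℝ (Fin 3)), H'.card = 6 ∧ ∀ r ∈ H', r ∈ X ∧ r ≠ q ∧ inner ℝ (r - p) (-n) = inner ℝ (q - p) (-n) ∧ dist q r = a) ∧ (∃ U' : Finset (EuclideanSpace ℝ (Fin 3)), U'.card = 3 ∧ ∀ r ∈ U', r ∈ X ∧ (∃ k : ℤ, inner ℝ (q - p) (-n) = c k ∧ inner ℝ (r - p) (-n) = c (k + 1)) ∧ dist q r = b) ∧ (∃ D' : Finset (EuclideanSpace ℝ (Fin 3)), D'.card = 3 ∧ ∀ r ∈ D', r ∈ X ∧ (∃ k : ℤ, inner ℝ (q - p) (-n) = c k ∧ inner ℝ (r - p) (-n) = c (k - 1)) ∧ dist q r = b) ∧ (∀ r ∈ X, r ≠ q → dist q r < 1 → (inner ℝ (r - p)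 (-n) = inner ℝ (q - p) (-n) → dist q r = a) ∧ (inner ℝ (r - p) (-n) ≠ inner ℝ (q - p) (-n) → dist q r = b)))))) → 19 / 25 ≤ √(b ^ 2 - a ^ 2 / 3)) → ∀ (X : Set (EuclideanSpace ℝ (Fin 3))), (0 : EuclideanSpace ℝ (Fin 3)) ∈ X → (∀ p ∈ X, ∃ (a b : ℝ) (n : EuclideanSpace ℝ (Fin 3)) (c : ℤ → ℝ), (19 / 20 ≤ a ∧ a ≤ 1 ∧ 19 / 20 ≤ b ∧ b ≤ 1 ∧ ‖n‖ = 1 ∧ c 0 = 0 ∧ (∀ k : ℤ, c k + 19 / 25 ≤ c (k + 1)) ∧ (∀ q ∈ X, ∀ r ∈ X, q ≠ r → 19 / 20 ≤ dist q r) ∧ (∀ q ∈ X, dist q p < 2 → ∃ k : ℤ, inner ℝ (q - p) n = c k) ∧ (∃ H U D : Finset (EuclideanSpace ℝ (Fin 3)), H.card = 6 ∧ U.card = 3 ∧ D.card = 3 ∧ (∀ q ∈ H, q ∈ X ∧ inner ℝ (q - p) n = 0 ∧ dist p q = a) ∧ (∀ q ∈ U, q ∈ X ∧ inner ℝ (q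 - p) n = c 1 ∧ dist p q = b) ∧ (∀ q ∈ D, q ∈ X ∧ inner ℝ (q - p) n = c (-1) ∧ dist p q = b) ∧ (∀ q ∈ X, q ≠ p → dist q p ≤ 1 → q ∈ H ∨ q ∈ U ∨ q ∈ D)) ∧ (∀ q ∈ X, q ≠ p → dist q p ≤ 1 → (∃ H' : Finset (EuclideanSpace ℝ (Fin 3)), H'.card = 6 ∧ ∀ r ∈ H', r ∈ X ∧ r ≠ q ∧ inner ℝ (r - p) n = inner ℝ (q - p) n ∧ dist q r = a) ∧ (∃ U' : Finset (EuclideanSpace ℝ (Fin 3)), U'.card = 3 ∧ ∀ r ∈ U', r ∈ X ∧ (∃ k : ℤ, inner ℝ (q - p) n = c k ∧ inner ℝ (r - p) n = c (k + 1)) ∧ dist q r = b) ∧ (∃ D' : Finset (EuclideanSpace ℝ (Fin 3)), D'.card = 3 ∧ ∀ r ∈ D', r ∈ X ∧ (∃ k : ℤ, inner ℝ (q - p) n = c k ∧ inner ℝ (r - p) n = c (k - 1)) ∧ dist q r = b) ∧ (∀ r ∈ X, r ≠ q → dist q r < 1 → (inner ℝ (r - p) n = inner ℝ (q - p) n → dist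 q r = a) ∧ (inner ℝ (r - p) n ≠ inner ℝ (q - p) n → dist q r = b))))) → ∃ a h : ℝ, 19 / 20 ≤ a ∧ a ≤ 1 ∧ 19 / 25 ≤ h ∧ (19 / 20) ^ 2 ≤ a ^ 2 / 3 + h ^ 2 ∧ a ^ 2 / 3 + h ^ 2 ≤ 1 ∧ ∃ s : ℤ → ℤ, Literature.MathematicalPhysics.StatisticalMechanics.IsHaggSeq s ∧ ∃ g : EuclideanSpace ℝ (Fin 3) ≃ᵢ EuclideanSpace ℝ (Fin 3), X = g '' Literature.MathematicalPhysics.StatisticalMechanics.barlowStacking a h s := by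
  intro hGap X h0 hall
  choose! fa fb fn fc hf using hall
  -- the bond component of `0`
  set K : Set (EuclideanSpace ℝ (Fin 3)) := {p | p ∈ X ∧ Relation.ReflTransGen (fun u v : EuclideanSpace ℝ (Fin 3) => u ∈ X ∧ v ∈ X ∧ dist u v ≤ 1) 0 p}
    with hKdef
  have hKX : K ⊆ X := fun p hp => hp.1
  have h0K : (0 : EuclideanSpace ℝ (Fin 3)) ∈ K := ⟨h0, Relation.ReflTransGen.refl⟩
  have hcl : ∀ q ∈ K, ∀ r ∈ X, dist q r ≤ 1 → r ∈ K :=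
    fun q hq r hr hqr => ⟨hr, hq.2.tail ⟨hq.1, hr, hqr⟩⟩
  -- propagation of the lengths (and, for two lengths, of the normal) along bonds
  have hprop : ∀ p : EuclideanSpace ℝ (Fin 3), Relation.ReflTransGen (fun u v : EuclideanSpace ℝ (Fin 3) => u ∈ X ∧ v ∈ X ∧ dist u v ≤ 1) 0 p →
      p ∈ X → fa p = fa 0 ∧ fb p = fb 0 ∧ (fa 0 ≠ fb 0 → fn p = fn 0 ∨ fn p = -fn 0) := by
    intro p hpath
    induction hpath with
    | refl => intro _; exact ⟨rfl, rfl, fun _ => Or.inl rfl⟩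
    | @tail u v _ hbond ih =>
      intro hv
      obtain ⟨hu, -, huv⟩ := hbond
      obtain ⟨hau, hbu, hnu⟩ := ih hu
      by_cases heq : u = v
      · subst heq; exact ⟨hau, hbu, hnu⟩
      · obtain ⟨ha, hb, hn⟩ := stub_frameDichotomy X u v (fa u) (fb u) (fa v) (fb v) (fn u) (fn v) (fc u) (fc v)
          hu hv heq huv (hf u hu) (hf v hv)
        refine ⟨ha.trans hau, hb.trans hbu, fun hne => ?_⟩
        have hne' : fa u ≠ fb u := by rwa [hau, hbu]
        rcases hn hne' with h1 | h1 <;> rcases hnu hne with h2 | h2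
        · exact Or.inl (h1.trans h2)
        · exact Or.inr (h1.trans h2)
        · exact Or.inr (by rw [h1, h2])
        · exact Or.inl (by rw [h1, h2, neg_neg])
  have hfr : ∀ p ∈ K, fa p = fa 0 ∧ fb p = fb 0 ∧ (fa 0 ≠ fb 0 → fn p = fn 0 ∨ fn p = -fn 0) :=
    fun p hp => hprop p hp.2 hp.1
  -- bounds from the frame of `0`
  obtain ⟨ha1, ha2, hb1, hb2, -, -, -, hsep, -⟩ := hf 0 h0
  -- the two cases
  have hK : ∃ a h : ℝ, 19 / 20 ≤ a ∧ a ≤ 1 ∧ 19 / 25 ≤ h ∧ (19 / 20) ^ 2 ≤ a ^ 2 / 3 + h ^ 2 ∧ a ^ 2 / 3 + h ^ 2 ≤ 1 ∧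
      0 < a ∧ a ≤ 1 ∧ 0 < h ∧ h ≤ 9 / 10 ∧
      ∃ s : ℤ → ℤ, IsHaggSeq s ∧ ∃ g : EuclideanSpace ℝ (Fin 3) ≃ᵢ EuclideanSpace ℝ (Fin 3), K = g '' barlowStacking a h s := by
    by_cases hlen : fa 0 = fb 0
    · -- one length: Hales's layer theorem (S12) on `K`
      obtain ⟨s, hs, g, hg⟩ := stub_barlowOfOneLength K (fa 0) ⟨0, h0K⟩ fun p hp => by
        obtain ⟨hpa, hpb, -⟩ := hfr p hp
        have h := locframe_restrict hKX hcl hp (hf p (hKX hp))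
        rw [hpa, hpb, ← hlen] at h
        exact ⟨fn p, fc p, h⟩
      have hsq : Real.sqrt (fa 0 ^ 2 - fa 0 ^ 2 / 3) ^ 2 = fa 0 ^ 2 - fa 0 ^ 2 / 3 :=
        Real.sq_sqrt (by nlinarith)
      have hh1 : 19 / 25 ≤ Real.sqrt (fa 0 ^ 2 - fa 0 ^ 2 / 3) :=
        Real.le_sqrt_of_sq_le (by nlinarith)
      exact ⟨fa 0, Real.sqrt (fa 0 ^ 2 - fa 0 ^ 2 / 3), ha1, ha2, hh1, by nlinarith, by nlinarith, by linarith, ha2,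
        by linarith, sqrt_gap_le ha1 ha2 ha1, s, hs, g, hg⟩
    · -- two lengths: common frame (S3) on `K`, gap bound from `hGap`
      obtain ⟨⟨s, hs, g, hg⟩, hh1⟩ :=
        (fun hfrK => And.intro (stub_barlowOfCommonNormal K (fa 0) (fb 0) (fn 0) ⟨0, h0K⟩ hfrK)
          (hGap K (fa 0) (fb 0) (fn 0) ⟨0, h0K⟩ hfrK)) fun p hp => by
          obtain ⟨hpa, hpb, hpn⟩ := hfr p hp
          have h := locframe_restrict hKX hcl hp (hf p (hKX hp))
          rw [hpa, hpb] at h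
          rcases hpn hlen with hn | hn
          · rw [hn] at h; exact Or.inl ⟨fc p, h⟩
          · rw [hn] at h; exact Or.inr ⟨fc p, h⟩
      have hsq : Real.sqrt (fb 0 ^ 2 - fa 0 ^ 2 / 3) ^ 2 = fb 0 ^ 2 - fa 0 ^ 2 / 3 :=
        Real.sq_sqrt (by nlinarith)
      exact ⟨fa 0, Real.sqrt (fb 0 ^ 2 - fa 0 ^ 2 / 3), ha1, ha2, hh1, by nlinarith, by nlinarith, by linarith, ha2,
        by linarith, sqrt_gap_le ha1 hb2 hb1, s, hs, g, hg⟩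
  obtain ⟨a, h, ha1', ha2', hh1', hlo, hhi, ha0, ha1'', hh0, hh9, s, hs, g, hg⟩ := hK
  have hXK : X = K := eq_of_barlow_subset X K hKX hsep a h ha0 ha1'' hh0 hh9 s g hg
  exact ⟨a, h, ha1', ha2', hh1', hlo, hhi, s, hs, g, hXK.trans hg⟩

/-- **Stub `stub_strongRigidity` of line `Sketch` (reshape 14), by name and signature.** [folklore] -/
theorem stub_strongRigidity :
    (∀ (X : Set (EuclideanSpace ℝ (Fin 3))) (a b : ℝ) (n : EuclideanSpace ℝ (Fin 3)), X.Nonempty → (∀ p ∈ X, (∃ c : ℤ → ℝ, (19 / 20 ≤ a ∧ a ≤ 1 ∧ 19 / 20 ≤ b ∧ b ≤ 1 ∧ ‖n‖ = 1 ∧ c 0 = 0 ∧ (∀ k : ℤ, c k + 19 / 25 ≤ c (k + 1)) ∧ (∀ q ∈ X, ∀ r ∈ X, q ≠ r → 19 / 20 ≤ dist q r) ∧ (∀ q ∈ X, dist q p < 2 → ∃ k : ℤ, inner ℝ (q - p) n = c k) ∧ (∃ H U D : Finset (EuclideanSpace ℝ (Fin 3)), H.card = 6 ∧ U.card = 3 ∧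 D.card = 3 ∧ (∀ q ∈ H, q ∈ X ∧ inner ℝ (q - p) n = 0 ∧ dist p q = a) ∧ (∀ q ∈ U, q ∈ X ∧ inner ℝ (q - p) n = c 1 ∧ dist p q = b) ∧ (∀ q ∈ D, q ∈ X ∧ inner ℝ (q - p) n = c (-1) ∧ dist p q = b) ∧ (∀ q ∈ X, q ≠ p → dist q p ≤ 1 → q ∈ H ∨ q ∈ U ∨ q ∈ D)) ∧ (∀ q ∈ X, q ≠ p → dist q p ≤ 1 → (∃ H' : Finset (EuclideanSpace ℝ (Fin 3)), H'.card = 6 ∧ ∀ r ∈ H', r ∈ X ∧ r ≠ q ∧ inner ℝ (r - p) n = inner ℝ (q - p) n ∧ dist q r = a) ∧ (∃ U' : Finset (EuclideanSpace ℝ (Fin 3)), U'.card = 3 ∧ ∀ r ∈ U', r ∈ X ∧ (∃ k : ℤ, inner ℝ (q - p) n = c k ∧ inner ℝ (r - p) n = c (k + 1)) ∧ dist q r = b) ∧ (∃ D' : Finset (EuclideanSpace ℝ (Fin 3)), D'.card = 3 ∧ ∀ r ∈ D', r ∈ X ∧ (∃ k : ℤ, inner ℝ (q - p) n = c k ∧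 inner ℝ (r - p) n = c (k - 1)) ∧ dist q r = b) ∧ (∀ r ∈ X, r ≠ q → dist q r < 1 → (inner ℝ (r - p) n = inner ℝ (q - p) n → dist q r = a) ∧ (inner ℝ (r - p) n ≠ inner ℝ (q - p) n → dist q r = b))))) ∨ (∃ c : ℤ → ℝ, (19 / 20 ≤ a ∧ a ≤ 1 ∧ 19 / 20 ≤ b ∧ b ≤ 1 ∧ ‖(-n)‖ = 1 ∧ c 0 = 0 ∧ (∀ k : ℤ, c k + 19 / 25 ≤ c (k + 1)) ∧ (∀ q ∈ X, ∀ r ∈ X, q ≠ r → 19 / 20 ≤ dist q r) ∧ (∀ q ∈ X, dist q p < 2 → ∃ k : ℤ, inner ℝ (q - p) (-n) = c k) ∧ (∃ H U D : Finset (EuclideanSpace ℝ (Fin 3)), H.card = 6 ∧ U.card = 3 ∧ D.card = 3 ∧ (∀ q ∈ H, q ∈ X ∧ inner ℝ (q - p) (-n) = 0 ∧ dist p q = a) ∧ (∀ q ∈ U, q ∈ X ∧ inner ℝ (q - p) (-n) = c 1 ∧ dist p q = b) ∧ (∀ q ∈ D, q ∈ X ∧ inner ℝ (q - p) (-n) =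 c (-1) ∧ dist p q = b) ∧ (∀ q ∈ X, q ≠ p → dist q p ≤ 1 → q ∈ H ∨ q ∈ U ∨ q ∈ D)) ∧ (∀ q ∈ X, q ≠ p → dist q p ≤ 1 → (∃ H' : Finset (EuclideanSpace ℝ (Fin 3)), H'.card = 6 ∧ ∀ r ∈ H', r ∈ X ∧ r ≠ q ∧ inner ℝ (r - p) (-n) = inner ℝ (q - p) (-n) ∧ dist q r = a) ∧ (∃ U' : Finset (EuclideanSpace ℝ (Fin 3)), U'.card = 3 ∧ ∀ r ∈ U', r ∈ X ∧ (∃ k : ℤ, inner ℝ (q - p) (-n) = c k ∧ inner ℝ (r - p) (-n) = c (k + 1)) ∧ dist q r = b) ∧ (∃ D' : Finset (EuclideanSpace ℝ (Fin 3)), D'.card = 3 ∧ ∀ r ∈ D', r ∈ X ∧ (∃ k : ℤ, inner ℝ (q - p) (-n) = c k ∧ inner ℝ (r - p) (-n) = c (k - 1)) ∧ dist q r = b) ∧ (∀ r ∈ X, r ≠ q → dist q r < 1 → (inner ℝ (r - p) (-n) = inner ℝ (q - p) (-n) → dist q r = a) ∧ (inner ℝ (r - p) (-n) ≠ inner ℝ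 (q - p) (-n) → dist q r = b)))))) → 19 / 25 ≤ √(b ^ 2 - a ^ 2 / 3)) → ∀ R ε : ℝ, 0 < ε → ∃ m : ℕ, ∀ (N : ℕ) (y : Fin N → EuclideanSpace ℝ (Fin 3)) (i : Fin N), (∀ jc : Fin N, dist (y jc) (y i) ≤ (m : ℝ) → (∃ a b : ℝ, 19 / 20 ≤ a ∧ a ≤ 1 ∧ 19 / 20 ≤ b ∧ b ≤ 1 ∧ ∃ n : EuclideanSpace ℝ (Fin 3), ‖n‖ = 1 ∧ ∃ c : ℤ → ℝ, (∀ k : ℤ, c k + 19 / 25 ≤ c (k + 1)) ∧ ∃ l : Fin N → ℤ, (∀ j : Fin N, dist (y j) (y jc) ≤ 2 → |inner ℝ (y j - y jc) n - c (l j)| ≤ 1 / ((m : ℝ) + 1)) ∧ (∀ j k : Fin N, dist (y j) (y jc) ≤ 2 → dist (y k) (y jc) ≤ 2 → j ≠ k → 19 / 20 ≤ dist (y j) (y k)) ∧ ∀ j : Fin N, dist (y j) (y jc) ≤ 1 → Nat.card {k : Fin N // k ≠ j ∧ l k = l j ∧ dist (y j) (y k) ≤ 1} = 6 ∧ Nat.card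 {k : Fin N // l k = l j + 1 ∧ dist (y j) (y k) ≤ 1} = 3 ∧ Nat.card {k : Fin N // l k = l j - 1 ∧ dist (y j) (y k) ≤ 1} = 3 ∧ ∀ k : Fin N, k ≠ j → dist (y j) (y k) ≤ 1 → (l k = l j → |dist (y j) (y k) - a| ≤ 1 / ((m : ℝ) + 1)) ∧ (l k ≠ l j → |dist (y j) (y k) - b| ≤ 1 / ((m : ℝ) + 1)))) → ∃ a h : ℝ, 19 / 20 ≤ a ∧ a ≤ 1 ∧ 19 / 25 ≤ h ∧ (19 / 20) ^ 2 ≤ a ^ 2 / 3 + h ^ 2 ∧ a ^ 2 / 3 + h ^ 2 ≤ 1 ∧ ∃ s : ℤ → ℤ, Literature.MathematicalPhysics.StatisticalMechanics.IsHaggSeq s ∧ ∃ z ∈ Literature.MathematicalPhysics.StatisticalMechanics.barlowStacking a h s, ∃ A : EuclideanSpace ℝ (Fin 3) →ₗᵢ[ℝ] EuclideanSpace ℝ (Fin 3), (∀ p ∈ Literature.MathematicalPhysics.StatisticalMechanics.barlowStacking a h s, dist p z ≤ R → ∃ j : Fin N, dist (y j) (y i + A (p - z)) ≤ ε) ∧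 (∀ j : Fin N, dist (y j) (y i) ≤ R → ∃ p ∈ Literature.MathematicalPhysics.StatisticalMechanics.barlowStacking a h s, dist (y j) (y i + A (p - z)) ≤ ε) := by
  intro hGap R ε hε
  by_contra hcon
  have H : ∀ m : ℕ, ∃ (N : ℕ) (y : Fin N → EuclideanSpace ℝ (Fin 3)) (i : Fin N),
      (∀ jc : Fin N, dist (y jc) (y i) ≤ (m : ℝ) → (∃ a b : ℝ, 19 / 20 ≤ a ∧ a ≤ 1 ∧ 19 / 20 ≤ b ∧ b ≤ 1 ∧ ∃ n : EuclideanSpace ℝ (Fin 3), ‖n‖ = 1 ∧ ∃ c : ℤ → ℝ, (∀ k : ℤ, c k + 19 / 25 ≤ c (k + 1)) ∧ ∃ l : Fin N → ℤ, (∀ j : Fin N, dist (y j) (y jc) ≤ 2 → |inner ℝ (y j - y jc) n - c (l j)| ≤ 1 / ((m : ℝ) + 1)) ∧ (∀ j k : Fin N, dist (y j) (y jc) ≤ 2 → dist (y k) (y jc) ≤ 2 → j ≠ k → 19 / 20 ≤ dist (y j) (y k)) ∧ ∀ j : Fin N, dist (y j) (y jc) ≤ 1 → Nat.card {k : Fin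 N // k ≠ j ∧ l k = l j ∧ dist (y j) (y k) ≤ 1} = 6 ∧ Nat.card {k : Fin N // l k = l j + 1 ∧ dist (y j) (y k) ≤ 1} = 3 ∧ Nat.card {k : Fin N // l k = l j - 1 ∧ dist (y j) (y k) ≤ 1} = 3 ∧ ∀ k : Fin N, k ≠ j → dist (y j) (y k) ≤ 1 → (l k = l j → |dist (y j) (y k) - a| ≤ 1 / ((m : ℝ) + 1)) ∧ (l k ≠ l j → |dist (y j) (y k) - b| ≤ 1 / ((m : ℝ) + 1)))) ∧
      ¬ (∃ a h : ℝ, 19 / 20 ≤ a ∧ a ≤ 1 ∧ 19 / 25 ≤ h ∧ (19 / 20) ^ 2 ≤ a ^ 2 / 3 + h ^ 2 ∧ a ^ 2 / 3 + h ^ 2 ≤ 1 ∧ ∃ s : ℤ → ℤ, Literature.MathematicalPhysics.StatisticalMechanics.IsHaggSeq s ∧ ∃ z ∈ Literature.MathematicalPhysics.StatisticalMechanics.barlowStacking a h s, ∃ A : EuclideanSpace ℝ (Fin 3) →ₗᵢ[ℝ] EuclideanSpace ℝ (Fin 3), (∀ p ∈ Literature.MathematicalPhysics.StatisticalMechanics.barlowStacking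 a h s, dist p z ≤ R → ∃ j : Fin N, dist (y j) (y i + A (p - z)) ≤ ε) ∧ (∀ j : Fin N, dist (y j) (y i) ≤ R → ∃ p ∈ Literature.MathematicalPhysics.StatisticalMechanics.barlowStacking a h s, dist (y j) (y i + A (p - z)) ≤ ε)) := by
    intro m
    by_contra hm
    exact hcon ⟨m, fun N y i hg => by_contra fun hb => hm ⟨N, y, i, hg, hb⟩⟩
  choose Nk yk ik hgood hbad using H
  obtain ⟨φ, X, hφ, hlim, h0, hfr⟩ := stub_localFrameLimit Nk yk ik hgood
  obtain ⟨a, h, ha1, ha2, hh1, hlo, hhi, s, hs, g, hXeq⟩ := barlow_of_localFrames' hGap X h0 hfr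
  -- the stacking point under `0` and the linear part of `g`
  have hz0 : g.symm 0 ∈ barlowStacking a h s := by
    have : (0 : EuclideanSpace ℝ (Fin 3)) ∈ g '' barlowStacking a h s := hXeq ▸ h0
    obtain ⟨z, hz, hz0⟩ := this
    rwa [← hz0, IsometryEquiv.symm_apply_apply]
  set z₀ := g.symm 0 with hz₀def
  set L := g.toRealLinearIsometryEquiv with hLdef
  have hgz : g z₀ = 0 := by rw [hz₀def, IsometryEquiv.apply_symm_apply]
  have hgp : ∀ p, g p = L (p - z₀) := fun p => by
    rw [isometryEquiv_apply_eq g p z₀, hgz, zero_add]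
  -- read back at a scale `k` with `φ k ≥ R`
  obtain ⟨k, hk, hkR⟩ := ((hlim R ε hε).and (Filter.eventually_ge_atTop ⌈R⌉₊)).exists
  have hkR' : R ≤ (φ k : ℝ) := by
    have h1 : R ≤ (⌈R⌉₊ : ℝ) := Nat.le_ceil R
    have h2 : (⌈R⌉₊ : ℝ) ≤ (k : ℝ) := by exact_mod_cast hkR
    have h3 : (k : ℝ) ≤ (φ k : ℝ) := by exact_mod_cast hφ.id_le k
    linarith
  apply hbad (φ k)
  refine ⟨a, h, ha1, ha2, hh1, hlo, hhi, s, hs, z₀, hz0, L.toLinearIsometry, ?_, ?_⟩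
  · intro p hp hpR
    have hgpX : g p ∈ X := by rw [hXeq]; exact ⟨p, hp, rfl⟩
    have hgp0 : dist (g p) 0 ≤ R := by rw [← hgz, g.dist_eq]; exact hpR
    obtain ⟨w, ⟨j, hj, rfl⟩, hw⟩ := hk.1 (g p) hgpX hgp0
    refine ⟨j, ?_⟩
    have : yk (φ k) (ik (φ k)) + L.toLinearIsometry (p - z₀) = yk (φ k) (ik (φ k)) + g p := by
      rw [hgp p]; rfl
    rw [this]
    calc dist (yk (φ k) j) (yk (φ k) (ik (φ k)) + g p)
        = dist (yk (φ k) j - yk (φ k) (ik (φ k))) (g p) := by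
          rw [dist_eq_norm, dist_eq_norm]; congr 1; abel
      _ ≤ ε := hw
  · intro j hj
    have hmem : yk (φ k) j - yk (φ k) (ik (φ k)) ∈ {p | ∃ j : Fin (Nk (φ k)),
        dist (yk (φ k) j) (yk (φ k) (ik (φ k))) ≤ (φ k : ℝ) ∧ p = yk (φ k) j - yk (φ k) (ik (φ k))} :=
      ⟨j, hj.trans hkR', rfl⟩
    have hnorm : dist (yk (φ k) j - yk (φ k) (ik (φ k))) 0 ≤ R := by
      rw [dist_zero_right, ← dist_eq_norm]; exact hj
    obtain ⟨x, hxX, hx⟩ := hk.2 _ hmem hnorm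
    rw [hXeq] at hxX
    obtain ⟨p, hp, rfl⟩ := hxX
    refine ⟨p, hp, ?_⟩
    have : yk (φ k) (ik (φ k)) + L.toLinearIsometry (p - z₀) = yk (φ k) (ik (φ k)) + g p := by
      rw [hgp p]; rfl
    rw [this]
    calc dist (yk (φ k) j) (yk (φ k) (ik (φ k)) + g p)
        = dist (yk (φ k) j - yk (φ k) (ik (φ k))) (g p) := by
          rw [dist_eq_norm, dist_eq_norm]; congr 1; abel
      _ ≤ ε := hx

end Summit.AtomisticToContinuum.Crystallization.Theorems.SquareWellLayerCake.StackingFaultSparsity.Bootstrap.StrongRigidity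

end
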